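import Summits.Parity.GeneralizedHardyLittlewood.Theorems.LiouvilleShiftedTablesTypeI2DilatedPeel5

/-!
# The peel, part 6/6: constants, thresholds and `stub_peel`

Route `LiouvilleShiftedTables` (Parity / GeneralizedHardyLittlewood), crux `TypeI2Dilated` (stmt-Parity-14272),
line `peel-to-drappeau`, registered stub `stub_peel : PeelStep` (`PeelStep := DrappeauTypeII → DilatedTypeIICore`,
vocabulary in `…Theorems.LiouvilleShiftedTablesDefs`).  THE PEEL moves the two rough moduli
(`r` and the dilation `q`, both `≤ x^ρ`) and their classes onto the coefficients, so that Drappeau's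
hypothesis-free Theorem 5.1 (S. Drappeau, Proc. LMS 114 (2017), arXiv:1504.05549, §5 — the Literature named
fact `Drappeau2017_theorem51`, taken as the hypothesis `DrappeauTypeII`) applies on the smooth modulus `s` alone:
CRT class `e mod lcm(q, r)` → `g ∣ mh` × a unit class expanded in characters `ξ mod L'` (absorbed into `α`, `β`),
the `(qr)^∞`-part `h` of the `β`-variable split off (`h ≤ x^{6ρ₀}`: Theorem 5.1 at `x' = MN/h` with
`a₁ = c·qr`, `a₂ = h·qr`; `h > x^{6ρ₀}`: the trivial bound (5.2) and `∑_{h ∣ (qr)^∞} h^{-1/2} ≤ τ(qr)²`),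
`ρ₀ = min(δ_{5.1}(η/2), η)/100`.  Everything here is PROVED; the only non-Mathlib inputs are the Literature
lemmas `Literature.NumberTheory.Sieve.DrappeauDispersionLemmas` (all proved) and the divisor bound
(`DivisorBound`, `DivisorPowerSums`).

The chain (each file imports the previous one):
* part 1: the peeled objects and THE PEEL identity (`…TypeI2DilatedPeel1`)
* part 2: matching Theorem 5.1; bounds for the peeled coefficients and blocks (`…TypeI2DilatedPeel2`)
* part 3: CRT, from blocks to the pair, and the main blocks via Theorem 5.1 (`…TypeI2DilatedPeel3`)
* part 4: the per-pair bound (`…TypeI2DilatedPeel4`)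
* part 5: the crux sum at one height `x` (`…TypeI2DilatedPeel5`)
* part 6: constants, thresholds and `stub_peel` (`…TypeI2DilatedPeel6`)

[this line; cite: Drappeau2017, Thm 5.1, §5 (5.1)–(5.2)]
-/

noncomputable section

namespace Summit.Parity.GeneralizedHardyLittlewood.Cruxes.TypeI2Dilated.PeelToDrappeau

open Finset Real
open scoped ArithmeticFunction.sigma Classical
open Literature.NumberTheory.Sieve Literature.NumberTheory.Sieve.Drappeau2017

/-! ### Constants, thresholds and `stub_peel` -/

/-- Eventually `K ≤ x^b` (`b > 0`) (renamed: `eventually_le_rpow` is taken by `…TypeI2DilatedURB2` in this namespace).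
[folklore] -/
theorem eventually_le_rpow_peel (Kc : ℝ) {b : ℝ} (hb : 0 < b) :
    ∀ᶠ x : ℝ in Filter.atTop, Kc ≤ x ^ b :=
  (tendsto_rpow_atTop hb).eventually_ge_atTop Kc

/-- **The divisor-power constant**: `τ(h)^K ≤ C_a^K h^{1/2}` when `τ(n) ≤ C_a n^{1/(2K+2)}`. [folklore] -/
theorem sigma_rpow_le_sqrt {K Ca : ℝ} (hK : 0 ≤ K) (hCa : 0 ≤ Ca)
    (h : ∀ n : ℕ, (σ 0 n : ℝ) ≤ Ca * (n : ℝ) ^ (1 / (2 * K + 2))) {n : ℕ} (hn : n ≠ 0) :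
    (σ 0 n : ℝ) ^ K ≤ Ca ^ K * (n : ℝ) ^ (1 / 2 : ℝ) := by
  have hn1 : (1 : ℝ) ≤ n := by exact_mod_cast Nat.one_le_iff_ne_zero.2 hn
  have hn0 : (0 : ℝ) ≤ n := by linarith
  calc (σ 0 n : ℝ) ^ K ≤ (Ca * (n : ℝ) ^ (1 / (2 * K + 2))) ^ K :=
        Real.rpow_le_rpow (Nat.cast_nonneg _) (h n) hK
    _ = Ca ^ K * (n : ℝ) ^ (1 / (2 * K + 2) * K) := by
        rw [Real.mul_rpow hCa (Real.rpow_nonneg hn0 _), ← Real.rpow_mul hn0]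
    _ ≤ Ca ^ K * (n : ℝ) ^ (1 / 2 : ℝ) := by
        refine mul_le_mul_of_nonneg_left (Real.rpow_le_rpow_of_exponent_le hn1 ?_)
          (Real.rpow_nonneg hCa _)
        rw [div_mul_eq_mul_div, one_mul, div_le_iff₀ (by linarith)]
        linarith

/-- **The logarithm is a small power**: `(log(256 x))^{|c₀|} ≤ 256 ((|c₀|+1)/ρ)^{|c₀|} x^ρ` for
`x ≥ 1`, `0 < ρ ≤ 1`. [folklore] -/
theorem log_rpow_le_rpow {x ρ : ℝ} (hx : 1 ≤ x) (hρ : 0 < ρ) (hρ1 : ρ ≤ 1) (c₀ : ℝ) :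
    Real.log (256 * x) ^ |c₀| ≤ (256 * ((|c₀| + 1) / ρ) ^ |c₀|) * x ^ ρ := by
  have hx0 : 0 < x := by linarith
  set ε : ℝ := ρ / (|c₀| + 1) with hε
  have hc0 : 0 < |c₀| + 1 := by positivity
  have hε0 : 0 < ε := by positivity
  have h256x : (1 : ℝ) ≤ 256 * x := by linarith
  have hlog0 : 0 ≤ Real.log (256 * x) := Real.log_nonneg h256x
  have h1 : Real.log (256 * x) ≤ (256 * x) ^ ε / ε := Real.log_le_rpow_div (by linarith) hε0
  have h2 : Real.log (256 * x) ^ |c₀| ≤ ((256 * x) ^ ε / ε) ^ |c₀| :=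
    Real.rpow_le_rpow hlog0 h1 (abs_nonneg _)
  have h3 : ((256 * x) ^ ε / ε) ^ |c₀| = (256 * x) ^ (ε * |c₀|) * (1 / ε) ^ |c₀| := by
    rw [div_eq_mul_one_div, Real.mul_rpow (Real.rpow_nonneg (by linarith) _) (by positivity),
      ← Real.rpow_mul (by linarith)]
  have h4 : (256 * x) ^ (ε * |c₀|) ≤ (256 * x) ^ ρ := by
    refine Real.rpow_le_rpow_of_exponent_le h256x ?_
    rw [hε, div_mul_eq_mul_div, div_le_iff₀ hc0]
    nlinarith [abs_nonneg c₀]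
  have h5 : (256 * x) ^ ρ ≤ 256 * x ^ ρ := by
    rw [Real.mul_rpow (by norm_num) hx0.le]
    refine mul_le_mul_of_nonneg_right ?_ (Real.rpow_nonneg hx0.le _)
    calc (256 : ℝ) ^ ρ ≤ (256 : ℝ) ^ (1 : ℝ) := Real.rpow_le_rpow_of_exponent_le (by norm_num) hρ1
      _ = 256 := Real.rpow_one _
  have h6 : (1 / ε) ^ |c₀| = ((|c₀| + 1) / ρ) ^ |c₀| := by rw [hε, one_div_div]
  calc Real.log (256 * x) ^ |c₀| ≤ (256 * x) ^ (ε * |c₀|) * (1 / ε) ^ |c₀| := h2.trans_eq h3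
    _ ≤ (256 * x ^ ρ) * (1 / ε) ^ |c₀| :=
        mul_le_mul_of_nonneg_right (h4.trans h5) (Real.rpow_nonneg (by positivity) _)
    _ = (256 * ((|c₀| + 1) / ρ) ^ |c₀|) * x ^ ρ := by rw [h6]; ring

/-- **The tail is negligible**: with `D = C_τ (2048x)^{ρ₀/(8K+8)}`, `H = x^{6ρ₀}`, `Λ₂ = D²(1 + log x)`,
`1 ≤ Rd ≤ x^{ρ₀}`: `4 (D^K)² (D + Rd Λ₂) H^{-1/2} ≤ C₄/Rd` with `C₄ = 16384 C_τ^{2K+2} (1 + 4/ρ₀)`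
(total `x`-exponent `2ρ₀ + ρ₀/4 + ρ₀/4 − 3ρ₀ < 0`). [this line] -/
theorem tail_bracket_le {x ρ₀ K Cτ Rd : ℝ} (hx : 1 ≤ x) (hρ₀ : 0 < ρ₀) (hρ₀1 : ρ₀ ≤ 1) (hK : 0 ≤ K)
    (hCτ : 1 ≤ Cτ) (hRd : 1 ≤ Rd) (hRdx : Rd ≤ x ^ ρ₀) :
    4 * ((Cτ * (2048 * x) ^ (ρ₀ / (8 * K + 8))) ^ K) ^ 2 *
        ((Cτ * (2048 * x) ^ (ρ₀ / (8 * K + 8))) +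
          Rd * ((Cτ * (2048 * x) ^ (ρ₀ / (8 * K + 8))) ^ 2 * (1 + Real.log x))) *
        (x ^ (6 * ρ₀)) ^ (-(1 / 2 : ℝ)) ≤
      (16384 * Cτ ^ (2 * K + 2) * (1 + 4 / ρ₀)) / Rd := by
  have hx0 : 0 < x := by linarith
  have hRd0 : 0 < Rd := by linarith
  set ε₃ : ℝ := ρ₀ / (8 * K + 8) with hε₃
  have hε₃0 : 0 < ε₃ := by positivity
  set t : ℝ := (2048 * x) ^ ε₃ with ht
  have ht1 : 1 ≤ t := Real.one_le_rpow (by linarith) hε₃0.le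
  set D : ℝ := Cτ * t with hD
  have hD1 : 1 ≤ D := one_le_mul_of_one_le_of_one_le hCτ ht1
  have hD0 : 0 < D := by linarith
  set L : ℝ := 1 + Real.log x with hL
  have hlogx : 0 ≤ Real.log x := Real.log_nonneg hx
  have hL1 : 1 ≤ L := by rw [hL]; linarith
  -- `H^{-1/2} = x^{-3ρ₀}`
  have hH : (x ^ (6 * ρ₀)) ^ (-(1 / 2 : ℝ)) = x ^ (-(3 * ρ₀)) := by
    rw [← Real.rpow_mul hx0.le]; ring_nf
  -- `(D^K)^2 = D^{2K}` and `D^{2K} D^2 = D^{2K+2}`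
  have hDK2 : (D ^ K) ^ 2 * D ^ 2 = D ^ (2 * K + 2) := by
    rw [← Real.rpow_natCast (D ^ K) 2, ← Real.rpow_mul hD0.le, ← Real.rpow_natCast D 2,
      ← Real.rpow_add hD0]
    norm_num
    ring_nf
  -- Step 1: `D + Rd D² L ≤ 2 Rd D² L`
  have h1 : D + Rd * (D ^ 2 * L) ≤ 2 * (Rd * (D ^ 2 * L)) := by
    have : D ≤ Rd * (D ^ 2 * L) := by
      calc D = 1 * (D * 1 * 1) := by ring
        _ ≤ Rd * (D * D * L) := by
            refine mul_le_mul hRd ?_ (by positivity) hRd0.le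
            exact mul_le_mul (mul_le_mul_of_nonneg_left hD1 hD0.le) hL1 zero_le_one (by positivity)
        _ = Rd * (D ^ 2 * L) := by ring
    linarith
  -- Step 2: `D^{2K+2} = Cτ^{2K+2} t^{2K+2}` and `t^{2K+2} = (2048 x)^{ρ₀/4} ≤ 2048 x^{ρ₀/4}`
  have hCτ0 : 0 ≤ Cτ := by linarith
  have ht0 : 0 ≤ t := by linarith
  have h2 : D ^ (2 * K + 2) ≤ Cτ ^ (2 * K + 2) * (2048 * x ^ (ρ₀ / 4)) := by
    rw [hD, Real.mul_rpow hCτ0 ht0]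
    refine mul_le_mul_of_nonneg_left ?_ (Real.rpow_nonneg hCτ0 _)
    rw [ht, ← Real.rpow_mul (by linarith)]
    have e1 : ε₃ * (2 * K + 2) = ρ₀ / 4 := by
      rw [hε₃]; field_simp; ring
    rw [e1, Real.mul_rpow (by norm_num) hx0.le]
    refine mul_le_mul_of_nonneg_right ?_ (Real.rpow_nonneg hx0.le _)
    calc (2048 : ℝ) ^ (ρ₀ / 4) ≤ (2048 : ℝ) ^ (1 : ℝ) :=
          Real.rpow_le_rpow_of_exponent_le (by norm_num) (by linarith)
      _ = 2048 := Real.rpow_one _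
  -- Step 3: `L ≤ (1 + 4/ρ₀) x^{ρ₀/4}`
  have h3 : L ≤ (1 + 4 / ρ₀) * x ^ (ρ₀ / 4) := by
    have hl : Real.log x ≤ x ^ (ρ₀ / 4) / (ρ₀ / 4) := Real.log_le_rpow_div hx0.le (by positivity)
    have h1x : (1 : ℝ) ≤ x ^ (ρ₀ / 4) := Real.one_le_rpow hx (by positivity)
    rw [hL, add_mul, one_mul]
    refine add_le_add h1x (hl.trans_eq ?_)
    field_simp
  -- Step 4: `Rd ≤ x^{ρ₀}`, assemble `T · Rd ≤ C₄`
  rw [le_div_iff₀ hRd0, hH]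
  have hxneg : 0 ≤ x ^ (-(3 * ρ₀)) := Real.rpow_nonneg hx0.le _
  calc 4 * (D ^ K) ^ 2 * (D + Rd * (D ^ 2 * L)) * x ^ (-(3 * ρ₀)) * Rd
      ≤ 4 * (D ^ K) ^ 2 * (2 * (Rd * (D ^ 2 * L))) * x ^ (-(3 * ρ₀)) * Rd := by
        gcongr
    _ = 8 * ((D ^ K) ^ 2 * D ^ 2) * L * (Rd * Rd) * x ^ (-(3 * ρ₀)) := by ring
    _ ≤ 8 * (Cτ ^ (2 * K + 2) * (2048 * x ^ (ρ₀ / 4))) * ((1 + 4 / ρ₀) * x ^ (ρ₀ / 4)) *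
          (x ^ ρ₀ * x ^ ρ₀) * x ^ (-(3 * ρ₀)) := by
        rw [hDK2]
        have hRR : Rd * Rd ≤ x ^ ρ₀ * x ^ ρ₀ := mul_le_mul hRdx hRdx hRd0.le (Real.rpow_nonneg hx0.le _)
        have hA : 0 ≤ Cτ ^ (2 * K + 2) * (2048 * x ^ (ρ₀ / 4)) := by positivity
        gcongr
    _ = 16384 * Cτ ^ (2 * K + 2) * (1 + 4 / ρ₀) *
          (x ^ (ρ₀ / 4) * x ^ (ρ₀ / 4) * x ^ ρ₀ * x ^ ρ₀ * x ^ (-(3 * ρ₀))) := by ring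
    _ = 16384 * Cτ ^ (2 * K + 2) * (1 + 4 / ρ₀) * x ^ (-(ρ₀ / 2)) := by
        congr 1
        rw [← Real.rpow_add hx0, ← Real.rpow_add hx0, ← Real.rpow_add hx0, ← Real.rpow_add hx0]
        ring_nf
    _ ≤ 16384 * Cτ ^ (2 * K + 2) * (1 + 4 / ρ₀) * 1 := by
        refine mul_le_mul_of_nonneg_left ?_ (by positivity)
        exact Real.rpow_le_one_of_one_le_of_nonpos hx (by linarith)
    _ = _ := by ring

/-- **The final bookkeeping**: `x^{2ρ} · C₂² x^ρ · 256 x · Br ≤ 256 C₂² E x^{1+4ρ}/Rd` once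
`Br ≤ E x^ρ/Rd`. [this line] -/
theorem final_algebra {x ρ Rd C₂ Br E : ℝ} (hx : 0 < x) (hBr : Br ≤ E * x ^ ρ / Rd) :
    x ^ ρ * x ^ ρ * (C₂ ^ 2 * x ^ ρ * (256 * x) * Br) ≤ (256 * C₂ ^ 2 * E) * x ^ (1 + 4 * ρ) / Rd := by
  have hx4 : x ^ (1 + 4 * ρ) = x * (x ^ ρ * x ^ ρ * x ^ ρ * x ^ ρ) := by
    rw [Real.rpow_add hx, Real.rpow_one, show (4 * ρ) = ρ + ρ + ρ + ρ by ring, Real.rpow_add hx,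
      Real.rpow_add hx, Real.rpow_add hx]
  calc x ^ ρ * x ^ ρ * (C₂ ^ 2 * x ^ ρ * (256 * x) * Br)
      = (x ^ ρ * x ^ ρ * (C₂ ^ 2 * x ^ ρ * (256 * x))) * Br := by ring
    _ ≤ (x ^ ρ * x ^ ρ * (C₂ ^ 2 * x ^ ρ * (256 * x))) * (E * x ^ ρ / Rd) :=
        mul_le_mul_of_nonneg_left hBr (by positivity)
    _ = (256 * C₂ ^ 2 * E) * x ^ (1 + 4 * ρ) / Rd := by rw [hx4]; ring

/-- STUB — **THE PEEL** (`DrappeauTypeII → DilatedTypeIICore`): CRT class `mod lcm(q, r)` →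
divisibility `g ∣ mh` × unit class expanded in characters `ξ mod L'` and absorbed into the
coefficients, the `(qr)^∞`-part `h` of the `β`-variable split off (`h ≤ x^{6ρ₀}`: Drappeau's
Theorem 5.1 at `x' = MN/h` with `a₁ = c·qr`, `a₂ = h·qr`; `h > x^{6ρ₀}`: trivial bound
`|𝔲_R| ≤ 1_{≡} + Rd τ²/s` and `∑_{h ∣ (qr)^∞} h^{-1/2} ≤ τ(qr)²`), with
`ρ₀ = min(δ(η/2), η)/100`. [this line; cite: Drappeau2017, Thm 5.1] -/
theorem stub_peel : PeelStep := by
  intro hD c hc η hη hη12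
  obtain ⟨δ, hδ, hA⟩ := hD (η / 2) (by linarith)
  -- the exponent `ρ₀`
  have hmin : 0 < min δ η := lt_min hδ hη
  set ρ₀ : ℝ := min δ η / 100 with hρ₀def
  have hρ₀pos : 0 < ρ₀ := by positivity
  have hρ₀δ : 100 * ρ₀ ≤ δ := by rw [hρ₀def]; linarith [min_le_left δ η]
  have hρ₀η : 100 * ρ₀ ≤ η := by rw [hρ₀def]; linarith [min_le_right δ η]
  have hρ₀1 : ρ₀ ≤ 1 / 1200 := by linarith
  refine ⟨ρ₀, hρ₀pos, fun ρ hρ hρρ₀ K hK => ?_⟩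
  -- exponent bookkeeping (all linear after the two products below)
  have hρδ : ρ₀ * δ ≤ 1 / 1200 * δ := mul_le_mul_of_nonneg_right hρ₀1 hδ.le
  have hρη : 0 ≤ ρ₀ * η := by positivity
  have x3 : 1 / 3 - η ≤ (1 / 2 - ρ₀) * (2 / 3 - η / 2) := by nlinarith
  have x5 : 1 / 2 + ρ ≤ (1 - 7 * ρ₀) * (1 / 2 + δ) := by nlinarith
  have x6 : ρ₀ ≤ (1 - 7 * ρ₀) * δ := by nlinarith
  have x8 : 6 * ρ₀ + 2 * ρ ≤ (1 - 7 * ρ₀) * δ := by nlinarith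
  have e1 : 0 < 1 - 7 * ρ₀ := by linarith
  have e2 : 0 < η / 2 - 6 * ρ₀ := by linarith
  have e4 : 0 < 1 / 4 - ρ₀ := by linarith
  have e7 : 0 < (1 - 7 * ρ₀) * δ - 2 * ρ := by nlinarith
  have e10 : 0 < 1 - ρ₀ := by linarith
  obtain ⟨C₅, c₀, x₅, h51⟩ := hA K hK
  -- divisor-bound constants
  obtain ⟨Ca, hCa1, hCa⟩ := exists_sigma_zero_le_mul_rpow (ε := 1 / (2 * K + 2)) (by positivity)
  obtain ⟨C₂, hC₂1, hC₂⟩ := exists_sigma_zero_le_mul_rpow (ε := (1 / 4 : ℝ)) (by norm_num)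
  obtain ⟨Cτ, hCτ1, hCτ⟩ := exists_sigma_zero_le_mul_rpow (ε := ρ₀ / (8 * K + 8)) (by positivity)
  have hC₁h : ∀ h : ℕ, h ≠ 0 → (σ 0 h : ℝ) ^ K ≤ Ca ^ K * (h : ℝ) ^ (1 / 2 : ℝ) := fun h hh =>
    sigma_rpow_le_sqrt hK (by linarith) hCa hh
  -- the constants
  set C₃ : ℝ := 256 * ((|c₀| + 1) / ρ) ^ |c₀| with hC₃
  set C₄ : ℝ := 16384 * Cτ ^ (2 * K + 2) * (1 + 4 / ρ₀) with hC₄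
  set C : ℝ := 256 * C₂ ^ 2 * (Ca ^ K * |C₅| * C₃ + C₄) with hCdef
  -- thresholds
  have hev : ∀ᶠ x : ℝ in Filter.atTop, 1 ≤ x ∧ x₅ ≤ x ^ (1 - 7 * ρ₀) ∧
      (256 : ℝ) ^ (η / 2) ≤ x ^ (η / 2 - 6 * ρ₀) ∧ (256 : ℝ) ^ (1 / 4 : ℝ) ≤ x ^ (1 / 4 - ρ₀) ∧
      |(c : ℝ)| ≤ x ^ ((1 - 7 * ρ₀) * δ - 2 * ρ) ∧ Real.exp 1 ≤ x ^ (1 - 7 * ρ₀) ∧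
      |(c : ℝ)| + 1 ≤ x ^ (1 - ρ₀) := by
    filter_upwards [Filter.eventually_ge_atTop (1 : ℝ), eventually_le_rpow_peel x₅ e1,
      eventually_le_rpow_peel ((256 : ℝ) ^ (η / 2)) e2, eventually_le_rpow_peel ((256 : ℝ) ^ (1 / 4 : ℝ)) e4,
      eventually_le_rpow_peel (|(c : ℝ)|) e7, eventually_le_rpow_peel (Real.exp 1) e1,
      eventually_le_rpow_peel (|(c : ℝ)| + 1) e10] with x h0 h1 h2 h3 h4 h5 h6
    exact ⟨h0, h1, h2, h3, h4, h5, h6⟩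
  obtain ⟨x₀, hx₀⟩ := Filter.eventually_atTop.1 hev
  refine ⟨C, x₀, fun x hx M N hN1 hN2 hMN1 hMN2 α β hα hβ u v R Slo Rd hR hSlo hSloR hRd hRdx => ?_⟩
  obtain ⟨hx1, d1, d2', d4', d7', d9, d10'⟩ := hx₀ x hx
  have hx0 : 0 < x := by linarith
  have hRd0 : 0 < Rd := by linarith
  -- the numerical side conditions at `x`
  have d2 : (256 * x) ^ (η / 2) ≤ x ^ η / x ^ (6 * ρ₀) := by
    rw [Real.mul_rpow (by norm_num) hx0.le, ← Real.rpow_sub hx0,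
      show η - 6 * ρ₀ = (η / 2 - 6 * ρ₀) + η / 2 by ring, Real.rpow_add hx0]
    exact mul_le_mul_of_nonneg_right d2' (Real.rpow_nonneg hx0.le _)
  have d3 : x ^ (1 / 3 - η) ≤ (x ^ (1 / 2 - ρ₀)) ^ (2 / 3 - η / 2) := by
    rw [← Real.rpow_mul hx0.le]
    exact Real.rpow_le_rpow_of_exponent_le hx1 x3
  have d4 : (256 * x) ^ (1 / 4 : ℝ) ≤ x ^ (1 / 2 - ρ₀) := by
    rw [Real.mul_rpow (by norm_num) hx0.le,
      show (1 / 2 - ρ₀) = (1 / 4 - ρ₀) + 1 / 4 by ring, Real.rpow_add hx0]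
    exact mul_le_mul_of_nonneg_right d4' (Real.rpow_nonneg hx0.le _)
  have d5 : x ^ (1 / 2 + ρ) ≤ (x ^ (1 - 7 * ρ₀)) ^ (1 / 2 + δ) := by
    rw [← Real.rpow_mul hx0.le]
    exact Real.rpow_le_rpow_of_exponent_le hx1 x5
  have d6 : x ^ ρ₀ ≤ (x ^ (1 - 7 * ρ₀)) ^ δ := by
    rw [← Real.rpow_mul hx0.le]
    exact Real.rpow_le_rpow_of_exponent_le hx1 x6
  have d7 : |(c : ℝ)| * x ^ (2 * ρ) ≤ (x ^ (1 - 7 * ρ₀)) ^ δ := by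
    rw [← Real.rpow_mul hx0.le,
      show (1 - 7 * ρ₀) * δ = ((1 - 7 * ρ₀) * δ - 2 * ρ) + 2 * ρ by ring, Real.rpow_add hx0]
    exact mul_le_mul_of_nonneg_right d7' (Real.rpow_nonneg hx0.le _)
  have d8 : x ^ (6 * ρ₀) * x ^ (2 * ρ) ≤ (x ^ (1 - 7 * ρ₀)) ^ δ := by
    rw [← Real.rpow_mul hx0.le, ← Real.rpow_add hx0]
    exact Real.rpow_le_rpow_of_exponent_le hx1 x8
  have d10 : |(c : ℝ)| < x ^ (1 - ρ₀) := by linarith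
  -- THE PEEL at `x`
  have main := peel_at h51 hK (by linarith) (by linarith) hδ.le hc hx1 hρ hρρ₀ (by linarith) hη.le
    hN1 hN2 hMN1 hMN2 hα hβ u v hR hSlo hSloR hRd hRdx (Real.rpow_nonneg (by linarith) K) hC₁h
    (fun n _ => hC₂ n) hCτ1 (by positivity) (fun n _ => hCτ n) d1 d2 d3 d4 d5 d6 d7 d8 d9 d10
  -- the bracket
  have hlog := log_rpow_le_rpow hx1 hρ (by linarith) c₀
  have htail := tail_bracket_le hx1 hρ₀pos (by linarith) hK hCτ1 hRd hRdx
  have hBr : Ca ^ K * (|C₅| * Real.log (256 * x) ^ |c₀|) / Rd +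
      4 * ((Cτ * (2048 * x) ^ (ρ₀ / (8 * K + 8))) ^ K) ^ 2 *
        ((Cτ * (2048 * x) ^ (ρ₀ / (8 * K + 8))) +
          Rd * ((Cτ * (2048 * x) ^ (ρ₀ / (8 * K + 8))) ^ 2 * (1 + Real.log x))) *
        (x ^ (6 * ρ₀)) ^ (-(1 / 2 : ℝ)) ≤
      (Ca ^ K * |C₅| * C₃ + C₄) * x ^ ρ / Rd := by
    have hxρ1 : 1 ≤ x ^ ρ := Real.one_le_rpow hx1 hρ.le
    have h1 : Ca ^ K * (|C₅| * Real.log (256 * x) ^ |c₀|) / Rd ≤ Ca ^ K * |C₅| * C₃ * x ^ ρ / Rd := by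
      refine div_le_div_of_nonneg_right ?_ hRd0.le
      calc Ca ^ K * (|C₅| * Real.log (256 * x) ^ |c₀|) = Ca ^ K * |C₅| * Real.log (256 * x) ^ |c₀| := by
            ring
        _ ≤ Ca ^ K * |C₅| * (C₃ * x ^ ρ) := mul_le_mul_of_nonneg_left hlog (by positivity)
        _ = _ := by ring
    have h2 : C₄ / Rd ≤ C₄ * x ^ ρ / Rd := by
      refine div_le_div_of_nonneg_right ?_ hRd0.le
      have hC₄0 : 0 ≤ C₄ := by positivity
      exact le_mul_of_one_le_right hC₄0 hxρ1
    calc _ ≤ Ca ^ K * |C₅| * C₃ * x ^ ρ / Rd + C₄ * x ^ ρ / Rd := add_le_add h1 (htail.trans h2)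
      _ = _ := by ring
  -- conclusion
  have final := final_algebra (C₂ := C₂) hx0 hBr
  have goal' : (∑ q ∈ Icc 1 ⌊x ^ ρ⌋₊, ∑ r ∈ Icc 1 ⌊R⌋₊, ‖T0 c Rd q r Slo M N α β (u r) (v q)‖) ≤
      C * x ^ (1 + 4 * ρ) / Rd := by
    rw [hCdef]; exact main.trans final
  simpa only [T0] using goal'

end Summit.Parity.GeneralizedHardyLittlewood.Cruxes.TypeI2Dilated.PeelToDrappeau

end
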